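/-
Copyright (c) 2026 the pub-hodgecm-mathlib formalisation cell (harness21).  Prover seat hodgecm-mathlib-A-p16 (g29), architect of road «S3-tree»
(ruling A-57 (a) S-a), 2026-09-01.
-/
import Mathlib.LinearAlgebra.Matrix.Charpoly.Coeff
import Literature.NumberTheory.Automorphic.UnitaryLatticeTreeFixedVertex   -- A-p16 (g29) S-a FILE 1: `exists_isVertex_mapGL_eq_of_mapGL_latt_eq`, `exists_isIntMatrix_pow_smul` (brings FILE 0 `…Framed`)
import HarnessLib

/-!
# A unitary element with INTEGRAL CHARACTERISTIC POLYNOMIAL stabilises a vertex lattice (the fixed-vertex lemma of the `U(N)` lattice tree, II: Cayley–Hamilton;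
# Bruhat–Tits 1972 §10 / Serre, *Trees* II.1.3)

Topic `NumberTheory/Automorphic`; namespace `Literature.NumberTheory.Automorphic.UnitaryLatticeTree`.  THEOREMS ONLY (no definition, no instance, no notation, no
named fact, no `sorry`); kernel lane.  Cell `pub/hodgecm-mathlib` (D-0151), crux H413 = `stmt-HodgeConjecture-24833`, road «S3-tree» (LEAD F0P3a-plan (g11) WORD T10-2),
END CONTRACT (F0P3a-p03 (g14), v2 8bf60abf) stub «SPAN», architect ruling A-57 (a) brick **S-a «VERTEX-FIXING»**, FILE 2 (FILE 0 = ★ `UnitaryLatticeTreeFramed`, FILE 1 =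
`UnitaryLatticeTreeFixedVertex`: a unitary `δ` stabilising SOME framed lattice stabilises a vertex).  WHY: in «SPAN» the conjugacy classes of `U(H′)(L⁺_v)` matched with a
`γ_H` in a compact subgroup consist of elements with INTEGRAL characteristic polynomial (the matching is conjugacy in the ambient `GL₃`, which preserves characteristic
polynomials); this file turns that into «stabilises a framed lattice», and FILE 1 into «stabilises a vertex», so every such element lies in a vertex stabiliser.
HONEST LABEL: HC_CM is proved only modulo the printed citations until rung 0 closes; elementary lattice algebra, pays no letter.

THE MATHEMATICS.  `δ ∈ GL_N(K)` with characteristic polynomial `X^N + c_{N−1}X^{N−1} + ⋯ + c₀`, all `|c_i| ≤ 1`, `|c₀| = |det δ| = 1`.  By Cayley–Hamilton every power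
`δ^k` maps `𝒪^N` into `P := 𝒪^N + Σ_{i<N} δ^i·𝒪^N` (induction on `k`), so `δP ≤ P`; and `c₀·δ⁻¹x = −Σ_{i≥1} c_i δ^{i−1}x` gives `δ⁻¹P ≤ P`; hence `δP = P`.  `P` is
squeezed between `𝒪^N` and `ϖ^{−m}𝒪^N`, so it is framed (★ FILE 0).  For unitary `δ`, `σ(det δ)·det δ = 1` forces `|det δ| = 1`, and FILE 1 upgrades the framed fixed lattice to a
fixed VERTEX.

* §4 `sum_charpoly_coeff_smul_pow_mulVec` (Cayley–Hamilton on vectors), `mapGL_pow_stdLattice_le`, **`exists_mapGL_latt_eq_of_charpoly`**.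
* §5 `map_det_mul_det_eq_one_of_mem_unitary`, `v_det_eq_one_of_mem_unitary`, **`exists_isVertex_mapGL_eq_of_charpoly`** (THE HEAD).

## References
* [BruhatTits1972] F. Bruhat, J. Tits, *Groupes réductifs sur un corps local I*, Publ. Math. IHÉS 41 (1972): §10 (lattice models; a compact element fixes a vertex).
* [Serre1980Trees] J.-P. Serre, *Trees* (1980): Ch. II §1.3 (an element of `GL₂` with integral characteristic polynomial and unit determinant fixes a vertex).
* [Jacobowitz1962] R. Jacobowitz, *Hermitian forms over local fields*, Amer. J. Math. 84 (1962): §4 (unitary determinants).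
-/

set_option autoImplicit false

noncomputable section

open scoped Valued WithZero Matrix MatrixGroups

namespace Literature.NumberTheory.Automorphic.UnitaryLatticeTree

open Literature.NumberTheory.Automorphic Literature.NumberTheory.Automorphic.HermitianLattice
open Literature.NumberTheory.Automorphic.CartanUnique

variable {K : Type*} [Field K] [Valued K ℤᵐ⁰] {N : ℕ}

/-! ## §4 An element with integral characteristic polynomial stabilises the framed lattice `Σ_{i<N} δ^i·𝒪^N` (Cayley–Hamilton) -/

section Charpoly

omit [Valued K ℤᵐ⁰] in
/-- The Cayley–Hamilton relation on vectors: `Σ_{i ≤ N} c_i • δ^i x = 0`, `c_i` the coefficients of the characteristic polynomial of `δ` (`c_N = 1`).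
[cite: Serre1980Trees, Ch. II §1.3] -/
theorem sum_charpoly_coeff_smul_pow_mulVec (δ : Matrix (Fin N) (Fin N) K) (x : Fin N → K) :
    ∑ i ∈ Finset.range (N + 1), δ.charpoly.coeff i • ((δ ^ i).mulVec x) = 0 := by
  have hCH := Matrix.aeval_self_charpoly δ
  rw [Polynomial.aeval_eq_sum_range, Matrix.charpoly_natDegree_eq_dim, Fintype.card_fin] at hCH
  have := congrArg (fun A : Matrix (Fin N) (Fin N) K => A.mulVec x) hCH
  simpa only [Matrix.sum_mulVec, Matrix.smul_mulVec, Matrix.zero_mulVec] using this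

/-- **ALL POWERS OF `δ` MAP `𝒪^N` INTO `P := 𝒪^N + Σ_{i<N} δ^i·𝒪^N`** when the characteristic polynomial of `δ` has integral coefficients (Cayley–Hamilton and
induction on the exponent). [cite: Serre1980Trees, Ch. II §1.3] -/
theorem mapGL_pow_stdLattice_le (δ : GL (Fin N) K) (hp : ∀ i, Valued.v ((δ : Matrix (Fin N) (Fin N) K).charpoly.coeff i) ≤ 1) (k : ℕ) :
    mapGL (δ ^ k) (stdLattice K N) ≤ stdLattice K N ⊔ ⨆ i : Fin N, mapGL (δ ^ (i : ℕ)) (stdLattice K N) := by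
  induction k using Nat.strong_induction_on with
  | _ k ih =>
    by_cases hk : k < N
    · exact le_sup_of_le_right (le_iSup (fun i : Fin N => mapGL (δ ^ (i : ℕ)) (stdLattice K N)) ⟨k, hk⟩)
    · push Not at hk
      rintro _ ⟨x, hx, rfl⟩
      rw [LinearMap.restrictScalars_apply, Matrix.toLin'_apply, Units.val_pow_eq_pow_val]
      -- Cayley–Hamilton at `δ^{k-N} x`
      have hCH := sum_charpoly_coeff_smul_pow_mulVec (δ : Matrix (Fin N) (Fin N) K) (((δ : Matrix (Fin N) (Fin N) K) ^ (k - N)).mulVec x)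
      simp_rw [Matrix.mulVec_mulVec, ← pow_add] at hCH
      have hcN : (δ : Matrix (Fin N) (Fin N) K).charpoly.coeff N = 1 := by
        have := (Matrix.charpoly_monic (δ : Matrix (Fin N) (Fin N) K)).coeff_natDegree
        rwa [Matrix.charpoly_natDegree_eq_dim, Fintype.card_fin] at this
      rw [Finset.sum_range_succ, hcN, one_smul, Nat.add_sub_cancel' hk] at hCH
      rw [eq_neg_of_add_eq_zero_right hCH]
      refine Submodule.neg_mem _ (Submodule.sum_mem _ fun i hi => smul_mem_of_v_le _ (hp i) ?_)
      have hik : i + (k - N) < k := by rw [Finset.mem_range] at hi; omega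
      exact ih _ hik ⟨x, hx, by rw [LinearMap.restrictScalars_apply, Matrix.toLin'_apply, Units.val_pow_eq_pow_val]⟩

variable [IsPrincipalIdealRing 𝒪[K]] {ϖ : K} (hϖ : Valued.v ϖ = WithZero.exp (-1 : ℤ))

include hϖ in
/-- **AN INVERTIBLE `δ` WITH INTEGRAL CHARACTERISTIC POLYNOMIAL AND UNIT DETERMINANT STABILISES A FRAMED LATTICE**: `P := 𝒪^N + Σ_{i<N} δ^i·𝒪^N` satisfies `δP = P`
(`δP ≤ P` by Cayley–Hamilton; `δ⁻¹P ≤ P` since `c₀ δ⁻¹x = −Σ_{i≥1} c_i δ^{i−1}x` with `|c₀| = |det δ| = 1`), and `𝒪^N ≤ P ≤ ϖ^{−m}𝒪^N` frames it (FILE 0).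
[cite: Serre1980Trees, Ch. II §1.3] [cite: BruhatTits1972, §10] -/
theorem exists_mapGL_latt_eq_of_charpoly (δ : GL (Fin N) K) (hp : ∀ i, Valued.v ((δ : Matrix (Fin N) (Fin N) K).charpoly.coeff i) ≤ 1)
    (hdet : Valued.v (δ : Matrix (Fin N) (Fin N) K).det = 1) :
    ∃ g : GL (Fin N) K, mapGL δ (latt (g : Matrix (Fin N) (Fin N) K)) = latt (g : Matrix (Fin N) (Fin N) K) := by
  classical
  have hϖ0 : ϖ ≠ 0 := fun h => by rw [h, map_zero] at hϖ; exact WithZero.coe_ne_zero hϖ.symm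
  set L₀ : Submodule 𝒪[K] (Fin N → K) := stdLattice K N with hL₀
  set P : Submodule 𝒪[K] (Fin N → K) := L₀ ⊔ ⨆ i : Fin N, mapGL (δ ^ (i : ℕ)) L₀ with hP
  have hpow : ∀ k : ℕ, mapGL (δ ^ k) L₀ ≤ P := mapGL_pow_stdLattice_le δ hp
  -- `δ P ≤ P`
  have hδP : mapGL δ P ≤ P := by
    rw [hP, mapGL, Submodule.map_sup, Submodule.map_iSup]
    refine sup_le ?_ (iSup_le fun i => ?_)
    · have := hpow 1
      rwa [pow_one] at this
    · change mapGL δ (mapGL (δ ^ (i : ℕ)) L₀) ≤ P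
      rw [← mapGL_mul, ← pow_succ']
      exact hpow _
  -- `δ⁻¹ 𝒪^N ≤ P`
  have hc0 : Valued.v ((δ : Matrix (Fin N) (Fin N) K).charpoly.coeff 0) = 1 := by
    have h := Matrix.det_eq_sign_charpoly_coeff (δ : Matrix (Fin N) (Fin N) K)
    rw [Fintype.card_fin] at h
    have h' : (δ : Matrix (Fin N) (Fin N) K).charpoly.coeff 0 = (-1) ^ N * (δ : Matrix (Fin N) (Fin N) K).det := by
      rw [h, ← mul_assoc, ← pow_add, ← two_mul, pow_mul, neg_one_sq, one_pow, one_mul]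
    rw [h', map_mul, map_pow, Valuation.map_neg, map_one, one_pow, one_mul, hdet]
  have hδinvL : mapGL δ⁻¹ L₀ ≤ P := by
    rintro _ ⟨x, hx, rfl⟩
    rw [LinearMap.restrictScalars_apply, Matrix.toLin'_apply]
    set y : Fin N → K := ((δ⁻¹ : GL (Fin N) K) : Matrix (Fin N) (Fin N) K).mulVec x with hy
    have hδy : (δ : Matrix (Fin N) (Fin N) K).mulVec y = x := by
      rw [hy, Matrix.mulVec_mulVec, ← Units.val_mul, mul_inv_cancel, Units.val_one, Matrix.one_mulVec]
    -- Cayley–Hamilton at `y`, split off the constant term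
    have hCH := sum_charpoly_coeff_smul_pow_mulVec (δ : Matrix (Fin N) (Fin N) K) y
    rw [Finset.sum_range_succ', pow_zero, Matrix.one_mulVec] at hCH
    simp_rw [pow_succ, ← Matrix.mulVec_mulVec, hδy] at hCH
    -- `c₀ • y ∈ P`
    have hc0y : (δ : Matrix (Fin N) (Fin N) K).charpoly.coeff 0 • y ∈ P := by
      rw [eq_neg_of_add_eq_zero_right hCH]
      refine Submodule.neg_mem _ (Submodule.sum_mem _ fun i _ => smul_mem_of_v_le _ (hp (i + 1)) ?_)
      exact hpow i ⟨x, hx, by rw [LinearMap.restrictScalars_apply, Matrix.toLin'_apply, Units.val_pow_eq_pow_val]⟩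
    have hc0ne : (δ : Matrix (Fin N) (Fin N) K).charpoly.coeff 0 ≠ 0 := fun h => by rw [h, map_zero] at hc0; exact zero_ne_one hc0
    have : y = ((δ : Matrix (Fin N) (Fin N) K).charpoly.coeff 0)⁻¹ • ((δ : Matrix (Fin N) (Fin N) K).charpoly.coeff 0 • y) := by
      rw [smul_smul, inv_mul_cancel₀ hc0ne, one_smul]
    rw [this]
    exact smul_mem_of_v_le _ (by rw [map_inv₀, hc0, inv_one]) hc0y
  -- `δ⁻¹ P ≤ P`
  have hδinvP : mapGL δ⁻¹ P ≤ P := by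
    rw [hP, mapGL, Submodule.map_sup, Submodule.map_iSup]
    refine sup_le hδinvL (iSup_le fun i => ?_)
    change mapGL δ⁻¹ (mapGL (δ ^ (i : ℕ)) L₀) ≤ P
    rw [← mapGL_mul]
    rcases Nat.eq_zero_or_pos (i : ℕ) with hi | hi
    · rw [hi, pow_zero, mul_one]; exact hδinvL
    · obtain ⟨j, hj⟩ := Nat.exists_eq_succ_of_ne_zero hi.ne'
      rw [hj, pow_succ', ← mul_assoc, inv_mul_cancel, one_mul]
      exact hpow j
  -- `δ P = P`
  have hδPeq : mapGL δ P = P := by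
    refine le_antisymm hδP ?_
    have := (mapGL_le_mapGL_iff δ _ _).2 hδinvP
    rwa [← mapGL_mul, mul_inv_cancel, mapGL_one] at this
  -- framing: `𝒪^N ≤ P ≤ ϖ^{-m} 𝒪^N`
  have hm : ∃ m : ℕ, ∀ i : Fin N, IsIntMatrix (ϖ ^ m • ((δ : Matrix (Fin N) (Fin N) K) ^ (i : ℕ))) := by
    choose m hm using fun i : Fin N => exists_isIntMatrix_pow_smul hϖ ((δ : Matrix (Fin N) (Fin N) K) ^ (i : ℕ))
    refine ⟨Finset.univ.sup m, fun i a b => ?_⟩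
    have hle : m i ≤ Finset.univ.sup m := Finset.le_sup (Finset.mem_univ i)
    obtain ⟨r, hr⟩ := Nat.exists_eq_add_of_le hle
    rw [hr, pow_add, mul_comm, ← smul_smul, Matrix.smul_apply, smul_eq_mul, map_mul]
    exact mul_le_one' (by rw [map_pow, hϖ, ← WithZero.exp_nsmul, ← WithZero.exp_zero, WithZero.exp_le_exp]; simp) (hm i a b)
  obtain ⟨m, hm⟩ := hm
  have hbU : IsUnit (Matrix.scalar (Fin N) ((ϖ ^ m)⁻¹) : Matrix (Fin N) (Fin N) K) :=
    (Matrix.scalar (Fin N)).isUnit_map (IsUnit.mk0 _ (inv_ne_zero (pow_ne_zero m hϖ0)))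
  obtain ⟨b, hb⟩ : ∃ b : GL (Fin N) K, (b : Matrix (Fin N) (Fin N) K) = Matrix.scalar (Fin N) ((ϖ ^ m)⁻¹) := ⟨hbU.unit, by simp⟩
  have hbinv : (b : Matrix (Fin N) (Fin N) K)⁻¹ = Matrix.scalar (Fin N) (ϖ ^ m) := by
    apply Matrix.inv_eq_left_inv
    rw [hb, ← map_mul, mul_inv_cancel₀ (pow_ne_zero m hϖ0), map_one]
  have hPb : P ≤ latt (b : Matrix (Fin N) (Fin N) K) := by
    have hterm : ∀ i : Fin N, mapGL (δ ^ (i : ℕ)) L₀ ≤ latt (b : Matrix (Fin N) (Fin N) K) := by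
      intro i
      change latt (((δ ^ (i : ℕ) : GL (Fin N) K)) : Matrix (Fin N) (Fin N) K) ≤ latt (b : Matrix (Fin N) (Fin N) K)
      rw [latt_le_latt_iff (Matrix.isUnits_det_units b), hbinv, Units.val_pow_eq_pow_val, Matrix.scalar_apply,
        ← Matrix.smul_one_eq_diagonal, Matrix.smul_mul, Matrix.one_mul]
      exact hm i
    refine sup_le ?_ (iSup_le hterm)
    -- `𝒪^N ≤ ϖ^{-m} 𝒪^N`
    rw [hL₀, ← latt_one, latt_le_latt_iff (Matrix.isUnits_det_units b), hbinv, Matrix.mul_one]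
    intro i j
    rw [Matrix.scalar_apply, Matrix.diagonal_apply]
    split_ifs
    · rw [map_pow, hϖ, ← WithZero.exp_nsmul, ← WithZero.exp_zero, WithZero.exp_le_exp]; simp
    · rw [map_zero]; exact zero_le
  obtain ⟨g, hg⟩ := exists_eq_latt_of_stdLattice_le_of_le_latt b P le_sup_left hPb
  exact ⟨g, by rw [← hg]; exact hδPeq⟩

end Charpoly

/-! ## §5 The head: a unitary element with integral characteristic polynomial fixes a vertex -/

section Head

variable [IsPrincipalIdealRing 𝒪[K]] (σ : K →+* K) (hσ : ∀ a, σ (σ a) = a) (hvσ : ∀ a, Valued.v (σ a) = Valued.v a)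
  {ϖ : K} (hϖ : Valued.v ϖ = WithZero.exp (-1 : ℤ))
  {H : Matrix (Fin N) (Fin N) K} (hH : IsUnit H.det) (hHh : (H.map σ)ᵀ = H)

omit [Valued K ℤᵐ⁰] [IsPrincipalIdealRing 𝒪[K]] in
/-- The determinant of a unitary matrix has `σ`-norm one: `σ(det δ) · det δ = 1` (`H` invertible). [cite: Jacobowitz1962, §4] -/
theorem map_det_mul_det_eq_one_of_mem_unitary {δ : GL (Fin N) K} (hδ : δ ∈ unitaryGroupOfForm σ H) (hH : IsUnit H.det) :
    σ (δ : Matrix (Fin N) (Fin N) K).det * (δ : Matrix (Fin N) (Fin N) K).det = 1 := by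
  have h := congrArg Matrix.det (mem_unitaryGroupOfForm_iff.1 hδ)
  have hσdet : ((δ : Matrix (Fin N) (Fin N) K).map σ).det = σ (δ : Matrix (Fin N) (Fin N) K).det := by
    rw [← RingHom.mapMatrix_apply, RingHom.map_det]
  simp only [Matrix.det_mul, Matrix.det_transpose, hσdet] at h
  have h' : (σ (δ : Matrix (Fin N) (Fin N) K).det * (δ : Matrix (Fin N) (Fin N) K).det) * H.det = 1 * H.det := by
    rw [one_mul]; linear_combination h
  exact mul_right_cancel₀ hH.ne_zero h'

include hvσ in
omit [IsPrincipalIdealRing 𝒪[K]] in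
/-- `|det δ| = 1` for a unitary `δ` (`σ` valuation-preserving, `H` invertible). [cite: Jacobowitz1962, §4] -/
theorem v_det_eq_one_of_mem_unitary {δ : GL (Fin N) K} (hδ : δ ∈ unitaryGroupOfForm σ H) (hH : IsUnit H.det) :
    Valued.v (δ : Matrix (Fin N) (Fin N) K).det = 1 := by
  have h := congrArg Valued.v (map_det_mul_det_eq_one_of_mem_unitary σ hδ hH)
  rw [map_mul, hvσ, map_one, ← sq] at h
  exact (pow_eq_one_iff.1 h).resolve_right two_ne_zero

include hσ hvσ hϖ hH hHh in
/-- **THE FIXED-VERTEX LEMMA.**  A unitary `δ ∈ U(σ, H)` whose characteristic polynomial has integral coefficients (e.g. `δ` conjugate in `GL_N` to an element of a compact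
subgroup; the elements of the classes matched with a compact `γ_H` in «SPAN») stabilises a VERTEX of the lattice tree: `∃ M, IsVertex σ ϖ H M ∧ δ·M = M`.  Hence it lies in a
vertex stabiliser. [cite: BruhatTits1972, §10] [cite: Serre1980Trees, Ch. II §1.3] -/
theorem exists_isVertex_mapGL_eq_of_charpoly {δ : GL (Fin N) K} (hδ : δ ∈ unitaryGroupOfForm σ H)
    (hp : ∀ i, Valued.v ((δ : Matrix (Fin N) (Fin N) K).charpoly.coeff i) ≤ 1) :
    ∃ M : Submodule 𝒪[K] (Fin N → K), IsVertex σ ϖ H M ∧ mapGL δ M = M := by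
  obtain ⟨g₀, hg₀⟩ := exists_mapGL_latt_eq_of_charpoly hϖ δ hp (v_det_eq_one_of_mem_unitary σ hvσ hδ hH)
  exact exists_isVertex_mapGL_eq_of_mapGL_latt_eq σ hσ hvσ hϖ hH hHh hδ g₀ hg₀

end Head

end Literature.NumberTheory.Automorphic.UnitaryLatticeTree

end
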